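import Literature.NumberTheory.EllipticCurves.CyclotomicIwasawaMainTheoremIrreducibleBaseChangeProofs
import Literature.NumberTheory.EllipticCurves.BurungaleCastellaSkinner2025.CyclotomicProductDivisibility
import Literature.NumberTheory.EllipticCurves.IrreducibleModPQuadraticTwistProofs
import Literature.NumberTheory.EllipticCurves.Rank1Residual.X9MuInvariant
import HarnessLib

/-!
# bsd.S21′ in `Λ` from `μ = 0`: Mazur's characteristic-ideal identity `ch_Λ X(E/ℚ_∞) = (L_p(E))`
# INTEGRALLY at a good ordinary `p ≥ 5` with irreducible `E[p]`, from Burungale–Castella–Skinner's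
# four-fold product divisibility (5.3) and the vanishing of `μ` at `E` and its three twists

`Proofs` companion (theorems only: no definition, no named fact) of
`CyclotomicIwasawaMainTheoremIrreducible.lean` (bsd.S21′ = Burungale–Castella–Skinner 2025
Thm. 1.1.2 (a), `burungale_castella_skinner_charIdeal_eq_padicLFunction`: `X` torsion and
`ch_Λ X = (g)`, `ι g = p^k · L_p(f, α)`, `k ∈ ℤ` FREE) and of
`BurungaleCastellaSkinner2025/CyclotomicProductDivisibility.lean` (display (5.3) of the proof of
Thm. 1.1.2, `display53_prod_charIdeal_le_prod_padicLFunction`: for the auxiliary fields `K, F` of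
Lemma 5.2.3, `(L_p(E) L_p(E^K) L_p(E^F) L_p(E^{FK})) ⊇ ch X(E) · ch X(E^K) · ch X(E^F) · ch X(E^{FK})`
in `Λ`, Mazur–Swinnerton-Dyer normalisation). Written for the print-tier cell `pub/bsd-print-x9`
(seat `bsd-print-x9-p1`: the residual class X9 of the BSD rank-`≤ 1` partition — non-surjective
irreducible image — where part (b) of Thm. 1.1.2 has the unsatisfiable hypothesis (im) and the
exponent `k = μ(X) − μ(L_p)` is the whole defect of the `p`-part); nothing here is specific to X9.

## What is proved

The tree already pins `k = 0` from `μ(X) = 0` AND an ANALYTIC certificate `μ(L_p) = 0`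
(`Rank1Residual.mazurMainConjecture_of_mu_eq_zero`, `X9MuInvariant.lean`). THIS FILE removes the
analytic input, using that under (irr_ℚ) alone the source proves more than (a), namely the
integral product divisibility (5.3). With (a) for each of the four curves `E, E^K, E^F, E^{FK}`,
`ι gᵢ = p^{kᵢ} Lᵢ`:
* `μ(X(Eᵢ)) = 0` and `Lᵢ ∈ ℤ_p⟦T⟧` (Greenberg–Vatsal 2000 Prop. 3.7, tree theorem
  `padicLFunction_mem_integral_holds`) give `kᵢ ≤ 0` (`exponent_nonpos_of_hasUnitContent`);
* (5.3) gives `Σ kᵢ ≥ 0`: writing `∏ gᵢ = r · G` and applying `ι`, the unit-normalised product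
  of the `Lᵢ` cancels in the domain `ℚ_p⟦T⟧` and leaves `p^{-Σ kᵢ} · (unit) · r(0) = 1` with
  `r(0) ∈ ℤ_p` (`exponents_eq_zero_of_prod_mem_span`);
hence every `kᵢ = 0`.

* §1 `exponent_nonpos_of_hasUnitContent`, `exponents_eq_zero_of_prod_mem_span`: `μ`-arithmetic.
* §2 `charIdeal_eq_padicLFunction_of_mu_eq_zero_of_twists`: at a good ordinary `p ≥ 5` with
  `E[p]` irreducible, `μ(X(E/ℚ_∞)) = 0` for the datum at hand (`hμ`) and `μ = 0`, guarded by
  torsion, for every cyclotomic dual datum of every globally minimal model of every quadratic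
  twist `E^{(d)}`, `d` squarefree, `p ∤ d` (`hμtw`) ⟹ `X` torsion and `ch X = (g)`,
  `ι g = L_p(f, α)` on the nose — Thm. 1.1.2 (b)'s conclusion with neither (im) nor any analytic
  certificate. Published binders: (a) (`hBCS`), (5.3) (`h53`), modularity (`hmod`, newforms of
  the twisted curves), the period unit `Ω_E = u·Ω⁺_f` (`h5`, Greenberg–Vatsal Rem. 3.4 — it names
  the MSD normalisation of (5.3) and makes the `ϖᵢ` units). The OPEN binders `hμ`, `hμtw` are
  instances of Greenberg's Conjecture 1.11 (LNM 1716), taken as hypotheses, never asserted.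

Honest status: a CONDITIONAL deduction from named facts (the registry flags of
`BurungaleCastellaSkinner2025` travel with `hBCS`, `h53`); no `_holds`; nothing asserted about any
curve. Consumers: `Summits/BirchSwinnertonDyer/BirchSwinnertonDyer/Theorems/PrintX9GreenbergMuLeaf.lean`
(Greenberg's conjecture ⟹ the typed X9 input `IntegralMainConjectureOnClassX9` ⟹ the K6 leaf).

References: [BurungaleCastellaSkinner2025] Thm. 1.1.2 (a) (p. 2), display (5.3) and Lemma 5.2.3
(p. 10 of arXiv:2405.00270v2); [GreenbergVatsal2000] Prop. 3.7, Rem. 3.4; [GreenbergLNM1716]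
Conj. 1.11. Design: theorems only; imports the two fact files, the `BaseChangeProofs` companion
(globally minimal models of twists, ordinarity), `IrreducibleModPQuadraticTwistProofs`
(irreducibility of twists) and `Rank1Residual/X9MuInvariant` (the period-ratio unit); nothing in
the tree imports this file.
-/

set_option autoImplicit false

noncomputable section

open scoped Classical MatrixGroups ModularForm

open CongruenceSubgroup WeierstrassCurve Field
open Literature.NumberTheory.EllipticCurves.ModularForms
open Literature.NumberTheory.EllipticCurves.Rank1Residual (norm_periodRatio_eq_one)
open Literature.NumberTheory.EllipticCurves.BurungaleCastellaSkinner2025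
  (display53_prod_charIdeal_le_prod_padicLFunction)

namespace Literature.NumberTheory.EllipticCurves

/-! ### §1 The `μ`-arithmetic in `Λ = ℤ_p⟦T⟧ ↪ ℚ_p⟦T⟧` -/

/-- **`μ(g) = 0` and `L` integral force the exponent to be `≤ 0`.** For `g ∈ Λ = ℤ_p⟦T⟧`,
`L ∈ ℚ_p⟦T⟧` with all coefficients of norm `≤ 1` (`hint`) and `ι g = p^k · L` (`h`): if `g` has
unit content then `k ≤ 0` (a unit coefficient of `g` reads `1 = p^{-k} ‖L_m‖ ≤ p^{-k}`). The half of
`Rank1Residual.exponent_eq_zero_of_hasUnitContent` that needs no analytic certificate (Greenberg–Vatsal's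
reading (2) of `μ = 0`: `p ∤ g` in `Λ`). [cite: GreenbergVatsal2000, p. 2, (1)–(2), and Prop. 3.7] -/
theorem exponent_nonpos_of_hasUnitContent {p : ℕ} [Fact p.Prime] (g : IwasawaAlgebra p)
    (L : PowerSeries ℚ_[p]) (k : ℤ)
    (h : iwasawaToPowerSeries p g = PowerSeries.C ((p : ℚ_[p]) ^ k) * L)
    (hint : ∀ n : ℕ, ‖PowerSeries.coeff n L‖ ≤ 1)
    (hg : GreenbergVatsal2000.HasUnitContent g) : k ≤ 0 := by
  have hpP : p.Prime := Fact.out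
  have hp1 : (1 : ℝ) < p := by exact_mod_cast hpP.one_lt
  have hcoeff : ∀ n : ℕ, ‖((PowerSeries.coeff n g : ℤ_[p]) : ℚ_[p])‖ =
      (p : ℝ) ^ (-k) * ‖PowerSeries.coeff n L‖ := by
    intro n
    have hn := congrArg (PowerSeries.coeff n) h
    rw [iwasawaToPowerSeries, PowerSeries.coeff_map, PowerSeries.coeff_C_mul] at hn
    change ((PowerSeries.coeff n g : ℤ_[p]) : ℚ_[p]) = _ at hn
    rw [hn, norm_mul, norm_zpow, Padic.norm_p, inv_zpow', zpow_neg]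
  obtain ⟨m, hm⟩ := (GreenbergVatsal2000.hasUnitContent_iff_exists_norm_eq_one g).mp hg
  have hge : (1 : ℝ) ≤ (p : ℝ) ^ (-k) := by
    have h1 : ‖((PowerSeries.coeff m g : ℤ_[p]) : ℚ_[p])‖ = 1 := by
      rw [PadicInt.padic_norm_e_of_padicInt]; exact hm
    rw [hcoeff m] at h1
    have hL1 : ‖PowerSeries.coeff m L‖ ≤ 1 := hint m
    have hpos : 0 ≤ (p : ℝ) ^ (-k) := zpow_nonneg (by positivity) _
    nlinarith
  by_contra hlt
  rw [not_le] at hlt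
  have h2 : (1 : ℝ) < (p : ℝ) ^ k := one_lt_zpow₀ hp1 hlt
  have h3 : (p : ℝ) ^ (-k) < 1 := by
    rw [zpow_neg]; exact inv_lt_one_of_one_lt₀ h2
  linarith

/-- **The product step.** In `Λ = ℤ_p⟦T⟧ ↪ ℚ_p⟦T⟧` (`ι = iwasawaToPowerSeries p`), let
`g₀, …, g₃, G ∈ Λ`, `L₀, …, L₃ ∈ ℚ_p⟦T⟧` with `L₀ L₁ L₂ L₃ ≠ 0`, natural numbers `mᵢ` with
`p^{mᵢ} · ι gᵢ = Lᵢ`, `u ∈ ℚ_p` with `‖u‖ ≤ 1`, `ι G = u · L₀ L₁ L₂ L₃` and `g₀ g₁ g₂ g₃ ∈ (G)`.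
Then every `mᵢ = 0`: writing `g₀ g₁ g₂ g₃ = r G`, `p^{Σ mᵢ} · u · ι r = 1` after cancelling the
product in the domain `ℚ_p⟦T⟧`, and the constant term gives `p^{-Σ mᵢ} ‖u‖ ‖r(0)‖ = 1` with
`‖u‖, ‖r(0)‖ ≤ 1`. (Burungale–Castella–Skinner, p. 10: "a proper divisibility in (5.4) would
contradict (5.3)", run with `μ` in place of Kato's divisibility.)
[cite: BurungaleCastellaSkinner2025, Proof of Thm. 1.1.2 (p. 10 of arXiv:2405.00270v2)] -/
theorem exponents_eq_zero_of_prod_mem_span {p : ℕ} [Fact p.Prime]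
    {g₀ g₁ g₂ g₃ G : IwasawaAlgebra p} {L₀ L₁ L₂ L₃ : PowerSeries ℚ_[p]} {m₀ m₁ m₂ m₃ : ℕ}
    (h₀ : PowerSeries.C ((p : ℚ_[p]) ^ m₀) * iwasawaToPowerSeries p g₀ = L₀)
    (h₁ : PowerSeries.C ((p : ℚ_[p]) ^ m₁) * iwasawaToPowerSeries p g₁ = L₁)
    (h₂ : PowerSeries.C ((p : ℚ_[p]) ^ m₂) * iwasawaToPowerSeries p g₂ = L₂)
    (h₃ : PowerSeries.C ((p : ℚ_[p]) ^ m₃) * iwasawaToPowerSeries p g₃ = L₃)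
    (hL : L₀ * L₁ * L₂ * L₃ ≠ 0) {u : ℚ_[p]} (hu : ‖u‖ ≤ 1)
    (hιG : iwasawaToPowerSeries p G = PowerSeries.C u * (L₀ * L₁ * L₂ * L₃))
    (hG : g₀ * g₁ * g₂ * g₃ ∈ Ideal.span {G}) :
    m₀ = 0 ∧ m₁ = 0 ∧ m₂ = 0 ∧ m₃ = 0 := by
  have hpP : p.Prime := Fact.out
  have hp1 : (1 : ℝ) < p := by exact_mod_cast hpP.one_lt
  obtain ⟨r, hr⟩ := Ideal.mem_span_singleton'.mp hG
  set ι' := iwasawaToPowerSeries p with hι'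
  set M : ℕ := m₀ + m₁ + m₂ + m₃ with hM
  -- `p^M · u · ι r · (L₀ L₁ L₂ L₃) = L₀ L₁ L₂ L₃`
  have key : PowerSeries.C ((p : ℚ_[p]) ^ M * u) * ι' r * (L₀ * L₁ * L₂ * L₃) =
      1 * (L₀ * L₁ * L₂ * L₃) := by
    have e1 : ι' r * ι' G = ι' g₀ * ι' g₁ * ι' g₂ * ι' g₃ := by
      rw [← map_mul, hr, map_mul, map_mul, map_mul]
    calc PowerSeries.C ((p : ℚ_[p]) ^ M * u) * ι' r * (L₀ * L₁ * L₂ * L₃)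
        = PowerSeries.C ((p : ℚ_[p]) ^ M) * (ι' r * (PowerSeries.C u * (L₀ * L₁ * L₂ * L₃))) := by
          rw [map_mul]; ring
      _ = PowerSeries.C ((p : ℚ_[p]) ^ M) * (ι' g₀ * ι' g₁ * ι' g₂ * ι' g₃) := by rw [← hιG, e1]
      _ = (PowerSeries.C ((p : ℚ_[p]) ^ m₀) * ι' g₀) * (PowerSeries.C ((p : ℚ_[p]) ^ m₁) * ι' g₁) *
            (PowerSeries.C ((p : ℚ_[p]) ^ m₂) * ι' g₂) *
            (PowerSeries.C ((p : ℚ_[p]) ^ m₃) * ι' g₃) := by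
          rw [hM, pow_add, pow_add, pow_add, map_mul, map_mul, map_mul]; ring
      _ = 1 * (L₀ * L₁ * L₂ * L₃) := by rw [h₀, h₁, h₂, h₃, one_mul]
  have hone : PowerSeries.C ((p : ℚ_[p]) ^ M * u) * ι' r = 1 := mul_right_cancel₀ hL key
  -- constant terms: `p^M · u · r(0) = 1` with `r(0) ∈ ℤ_p`
  have hconst : (p : ℚ_[p]) ^ M * u * ((PowerSeries.coeff 0 r : ℤ_[p]) : ℚ_[p]) = 1 := by
    have h := congrArg (PowerSeries.coeff 0) hone
    rw [PowerSeries.coeff_C_mul, PowerSeries.coeff_one, if_pos rfl] at h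
    rw [← h, hι', iwasawaToPowerSeries, PowerSeries.coeff_map]
    rfl
  set r₀ : ℚ_[p] := ((PowerSeries.coeff 0 r : ℤ_[p]) : ℚ_[p]) with hr₀
  have hnorm : ‖(p : ℚ_[p]) ^ M‖ * (‖u‖ * ‖r₀‖) = 1 := by
    rw [← norm_mul, ← norm_mul, ← mul_assoc, hconst, norm_one]
  have hr1 : ‖r₀‖ ≤ 1 := by
    rw [hr₀, PadicInt.padic_norm_e_of_padicInt]; exact PadicInt.norm_le_one _
  have hprod : ‖u‖ * ‖r₀‖ ≤ 1 := by
    calc ‖u‖ * ‖r₀‖ ≤ 1 * 1 := mul_le_mul hu hr1 (norm_nonneg _) zero_le_one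
      _ = 1 := one_mul 1
  have hle1 : (1 : ℝ) ≤ ‖(p : ℚ_[p]) ^ M‖ := by
    have hab : ‖(p : ℚ_[p]) ^ M‖ * (‖u‖ * ‖r₀‖) ≤ ‖(p : ℚ_[p]) ^ M‖ :=
      mul_le_of_le_one_right (norm_nonneg _) hprod
    rwa [hnorm] at hab
  have hpM : ‖(p : ℚ_[p]) ^ M‖ = (p : ℝ) ^ (-(M : ℤ)) := Padic.norm_p_pow M
  have hM0 : M = 0 := by
    by_contra hM0
    have hMpos : 0 < M := Nat.pos_of_ne_zero hM0
    have hlt : (p : ℝ) ^ (-(M : ℤ)) < 1 := by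
      rw [zpow_neg]
      exact inv_lt_one_of_one_lt₀ (one_lt_zpow₀ hp1 (by exact_mod_cast hMpos))
    rw [hpM] at hle1
    exact absurd (lt_of_le_of_lt hle1 hlt) (lt_irrefl 1)
  omega

/-! ### §2 Per pair: `μ = 0` at `E` and at its quadratic twists ⟹ the integral main conjecture -/

/-- **Per pair (the print road under (irr_ℚ) only, plus Greenberg's `μ = 0`).** Let `W/ℚ` be
globally minimal, `p ≥ 5` a prime of good ordinary reduction with `E[p]` irreducible, `(κ, γ)`
cyclotomic, `f` a newform of `E`, `D` a Pontryagin-dual datum. PUBLISHED binders: Burungale–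
Castella–Skinner 2025 Thm. 1.1.2 (a) (`hBCS`) and display (5.3) of its proof (`h53`), modularity
(`hmod`, newforms of the twisted curves), the period unit `Ω_E = u·Ω⁺_f` (`h5`, Greenberg–Vatsal
Rem. 3.4). OPEN binders: `μ(X) = 0` for `D` (`hμ`) and for every dual datum over `(κ, γ)` of every
globally minimal model of every quadratic twist `E^{(d)}`, `d` squarefree prime to `p` (`hμtw`,
guarded by torsion) — instances of Greenberg's Conj. 1.11. THEN `X` is `Λ`-torsion and
`ch_Λ X = (g)` with `ι g = L_p(f, α)` on the nose: Thm. 1.1.2 (b)'s conclusion without (im) and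
without any analytic certificate.
[cite: BurungaleCastellaSkinner2025, Thm. 1.1.2 (a) (p. 2) and display (5.3) (p. 10) of arXiv:2405.00270v2]
[cite: GreenbergVatsal2000, Prop. 3.7 and Rem. 3.4] [cite: GreenbergLNM1716, §1 Conj. 1.11] -/
theorem charIdeal_eq_padicLFunction_of_mu_eq_zero_of_twists
    (hBCS : burungale_castella_skinner_charIdeal_eq_padicLFunction)
    (h53 : display53_prod_charIdeal_le_prod_padicLFunction)
    (hmod : exists_isNewformOf) (h5 : realPeriodRat_eq_unit_mul_plusPeriod)
    (W : WeierstrassCurve ℚ) [W.IsElliptic] [W.IsGloballyMinimal] (p : ℕ) [Fact p.Prime]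
    (hp : 5 ≤ p) (hgood : W.HasGoodReductionAtPrime p) (hord : ¬ (p : ℤ) ∣ W.frobeniusTrace p)
    (hirr : W.HasIrreducibleModPGaloisRep p)
    (κ : ZpExtension ℚ p) (γ : Field.absoluteGaloisGroup ℚ) (hκ : κ.IsCyclotomic)
    (hγ : κ.IsTopGenerator γ) (hγ' : IsCyclotomicVariable p γ)
    {N : ℕ} [NeZero N] (f : CuspForm (Gamma0 N) 2) (hf : IsNewformOf W f)
    (D : W.SelmerDualData κ γ) (hμ : D.mu = 0)
    (hμtw : ∀ (d : ℤ) (W' : WeierstrassCurve ℚ) [W'.IsElliptic] [W'.IsGloballyMinimal],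
      Squarefree d → ¬ (p : ℤ) ∣ d →
      (∃ C : VariableChange ℚ, C • W' = W.quadraticTwist (d : ℚ)) →
      ∀ D' : W'.SelmerDualData κ γ, D'.IsTorsion → D'.mu = 0) :
    D.IsTorsion ∧ ∃ g : IwasawaAlgebra p, D.charIdeal = Ideal.span {g} ∧
      iwasawaToPowerSeries p g = padicLFunction f (unitRoot W p : ℚ_[p]) := by
  have hp2 : p ≠ 2 := by omega
  have hpP : p.Prime := Fact.out
  have hpZ : Prime (p : ℤ) := Nat.prime_iff_prime_int.mp hpP
  -- the auxiliary discriminants of Lemma 5.2.3 and display (5.3)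
  obtain ⟨dK, dF, hK0, -, hKsq, -, hF1, -, hFsq, hKF, hcop, -, -, H⟩ :=
    h53 W p κ γ f hp hgood hord hirr hκ hγ hγ' hf
  have hpunit : ¬ IsUnit (p : ℤ) := by
    rw [Int.isUnit_iff_natAbs_eq, Int.natAbs_natCast]
    exact hpP.one_lt.ne'
  have hpK : ¬ (p : ℤ) ∣ dK := fun h =>
    hpunit (hcop.isUnit_of_dvd' (dvd_mul_of_dvd_left h _) (dvd_mul_right _ _))
  have hpF : ¬ (p : ℤ) ∣ dF := fun h =>
    hpunit (hcop.isUnit_of_dvd' (dvd_mul_of_dvd_right h _) (dvd_mul_right _ _))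
  have hpKF : ¬ (p : ℤ) ∣ dK * dF := fun h => (hpZ.dvd_or_dvd h).elim hpK hpF
  have hKFsq : Squarefree (dK * dF) := squarefree_mul_iff.mpr ⟨hKF.isRelPrime, hKsq, hFsq⟩
  have hF0 : dF ≠ 0 := by omega
  have hK0' : (dK : ℚ) ≠ 0 := by exact_mod_cast hK0.ne
  have hF0' : (dF : ℚ) ≠ 0 := by exact_mod_cast hF0
  have hKF0' : ((dK * dF : ℤ) : ℚ) ≠ 0 := by exact_mod_cast mul_ne_zero hK0.ne hF0
  -- globally minimal models of the three twists: good ordinary, irreducible at `p`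
  obtain ⟨W₁, hE₁, hM₁, C₁, hC₁⟩ := exists_isGloballyMinimal_smul_eq_quadraticTwist W hK0'
  obtain ⟨W₂, hE₂, hM₂, C₂, hC₂⟩ := exists_isGloballyMinimal_smul_eq_quadraticTwist W hF0'
  obtain ⟨W₃, hE₃, hM₃, C₃, hC₃⟩ := exists_isGloballyMinimal_smul_eq_quadraticTwist W hKF0'
  have hW : IsOrdinaryAt W p := ⟨hgood, hord⟩
  have hord₁ : IsOrdinaryAt W₁ p :=
    isOrdinaryAt_of_smul_eq_quadraticTwist W W₁ hKsq hC₁ p hp2 hpK hW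
  have hord₂ : IsOrdinaryAt W₂ p :=
    isOrdinaryAt_of_smul_eq_quadraticTwist W W₂ hFsq hC₂ p hp2 hpF hW
  have hord₃ : IsOrdinaryAt W₃ p :=
    isOrdinaryAt_of_smul_eq_quadraticTwist W W₃ hKFsq hC₃ p hp2 hpKF hW
  have hirr₁ : W₁.HasIrreducibleModPGaloisRep p :=
    (W.hasIrreducibleModPGaloisRep_iff_of_smul_eq_quadraticTwist W₁ hK0' hC₁ p).mpr hirr
  have hirr₂ : W₂.HasIrreducibleModPGaloisRep p :=
    (W.hasIrreducibleModPGaloisRep_iff_of_smul_eq_quadraticTwist W₂ hF0' hC₂ p).mpr hirr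
  have hirr₃ : W₃.HasIrreducibleModPGaloisRep p :=
    (W.hasIrreducibleModPGaloisRep_iff_of_smul_eq_quadraticTwist W₃ hKF0' hC₃ p).mpr hirr
  -- their newforms (modularity) and Selmer data
  haveI : NeZero (W₁.conductorNorm ℤ) := ⟨(W₁.conductorNorm_pos_holds).ne'⟩
  haveI : NeZero (W₂.conductorNorm ℤ) := ⟨(W₂.conductorNorm_pos_holds).ne'⟩
  haveI : NeZero (W₃.conductorNorm ℤ) := ⟨(W₃.conductorNorm_pos_holds).ne'⟩
  obtain ⟨f₁, hf₁⟩ := hmod W₁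
  obtain ⟨f₂, hf₂⟩ := hmod W₂
  obtain ⟨f₃, hf₃⟩ := hmod W₃
  set D₁ : W₁.SelmerDualData κ γ := W₁.selmerDualData κ hγ with hD₁
  set D₂ : W₂.SelmerDualData κ γ := W₂.selmerDualData κ hγ with hD₂
  set D₃ : W₃.SelmerDualData κ γ := W₃.selmerDualData κ hγ with hD₃
  -- the MSD normalisation constants `ϖᵢ = Ω⁺_{fᵢ} / Ω_{Eᵢ}`, `p`-adic units
  have hϖex : ∀ (V : WeierstrassCurve ℚ) [V.IsElliptic] [V.IsGloballyMinimal],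
      V.HasGoodReductionAtPrime p → V.HasIrreducibleModPGaloisRep p →
      ∀ {M : ℕ} [NeZero M] (φ : CuspForm (Gamma0 M) 2), IsNewformOf V φ →
      ∃ ϖ : ℚ, (ϖ : ℝ) * V.realPeriodRat = plusPeriod φ ∧ ‖(ϖ : ℚ_[p])‖ = 1 := by
    intro V _ _ hVgood hVirr M _ φ hφ
    obtain ⟨u, hu1, huΩ⟩ := h5 V p hp hVgood hVirr φ hφ
    have hu0 : (u : ℝ) ≠ 0 := by
      have : (u : ℚ_[p]) ≠ 0 := fun h0 => by rw [h0, norm_zero] at hu1; exact zero_ne_one hu1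
      exact_mod_cast (show u ≠ 0 from fun h0 => this (by rw [h0]; push_cast; rfl))
    refine ⟨u⁻¹, ?_, ?_⟩
    · rw [huΩ, Rat.cast_inv, ← mul_assoc, inv_mul_cancel₀ hu0, one_mul]
    · rw [Rat.cast_inv, norm_inv, hu1, inv_one]
  obtain ⟨ϖ₀, hϖ₀, hϖ₀n⟩ := hϖex W hgood hirr f hf
  obtain ⟨ϖ₁, hϖ₁, hϖ₁n⟩ := hϖex W₁ hord₁.1 hirr₁ f₁ hf₁
  obtain ⟨ϖ₂, hϖ₂, hϖ₂n⟩ := hϖex W₂ hord₂.1 hirr₂ f₂ hf₂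
  obtain ⟨ϖ₃, hϖ₃, hϖ₃n⟩ := hϖex W₃ hord₃.1 hirr₃ f₃ hf₃
  -- (5.3)
  obtain ⟨G, hιG, hG⟩ := H W₁ W₂ W₃ ⟨C₁, hC₁⟩ ⟨C₂, hC₂⟩ ⟨C₃, hC₃⟩ f₁ f₂ f₃ hf₁ hf₂ hf₃
    ϖ₀ ϖ₁ ϖ₂ ϖ₃ hϖ₀ hϖ₁ hϖ₂ hϖ₃ D D₁ D₂ D₃
  -- (a) for the four curves
  obtain ⟨ht₀, g₀, k₀, hc₀, hι₀⟩ := hBCS W p κ γ f hp hgood hord hirr hκ hγ hγ' hf D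
  obtain ⟨ht₁, g₁, k₁, hc₁, hι₁⟩ := hBCS W₁ p κ γ f₁ hp hord₁.1 hord₁.2 hirr₁ hκ hγ hγ' hf₁ D₁
  obtain ⟨ht₂, g₂, k₂, hc₂, hι₂⟩ := hBCS W₂ p κ γ f₂ hp hord₂.1 hord₂.2 hirr₂ hκ hγ hγ' hf₂ D₂
  obtain ⟨ht₃, g₃, k₃, hc₃, hι₃⟩ := hBCS W₃ p κ γ f₃ hp hord₃.1 hord₃.2 hirr₃ hκ hγ hγ' hf₃ D₃
  -- `μ = 0` for the four data, as unit content of the generators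
  haveI : Module.Finite (IwasawaAlgebra p) D.X := D.module_finite_holds hγ
  haveI : Module.Finite (IwasawaAlgebra p) D₁.X := D₁.module_finite_holds hγ
  haveI : Module.Finite (IwasawaAlgebra p) D₂.X := D₂.module_finite_holds hγ
  haveI : Module.Finite (IwasawaAlgebra p) D₃.X := D₃.module_finite_holds hγ
  have hu₀ : GreenbergVatsal2000.HasUnitContent g₀ :=
    (GreenbergVatsal2000.mu_eq_zero_iff_hasUnitContent D ht₀ hc₀).mp hμ
  have hu₁ : GreenbergVatsal2000.HasUnitContent g₁ :=
    (GreenbergVatsal2000.mu_eq_zero_iff_hasUnitContent D₁ ht₁ hc₁).mp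
      (hμtw dK W₁ hKsq hpK ⟨C₁, hC₁⟩ D₁ ht₁)
  have hu₂ : GreenbergVatsal2000.HasUnitContent g₂ :=
    (GreenbergVatsal2000.mu_eq_zero_iff_hasUnitContent D₂ ht₂ hc₂).mp
      (hμtw dF W₂ hFsq hpF ⟨C₂, hC₂⟩ D₂ ht₂)
  have hu₃ : GreenbergVatsal2000.HasUnitContent g₃ :=
    (GreenbergVatsal2000.mu_eq_zero_iff_hasUnitContent D₃ ht₃ hc₃).mp
      (hμtw (dK * dF) W₃ hKFsq hpKF ⟨C₃, by rw [hC₃]⟩ D₃ ht₃)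
  -- integrality of the four `p`-adic `L`-functions (Greenberg–Vatsal Prop. 3.7) ⟹ `kᵢ ≤ 0`
  have hint : ∀ (V : WeierstrassCurve ℚ) [V.IsElliptic] [V.IsGloballyMinimal],
      IsOrdinaryAt V p → V.HasIrreducibleModPGaloisRep p →
      ∀ {M : ℕ} [NeZero M] (φ : CuspForm (Gamma0 M) 2), IsNewformOf V φ →
      ∀ n : ℕ, ‖PowerSeries.coeff n (padicLFunction φ (unitRoot V p : ℚ_[p]))‖ ≤ 1 := by
    intro V _ _ hV hVirr M _ φ hφ n
    rw [coeff_padicLFunction]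
    exact padicLFunction_mem_integral_holds hp2 hV hφ hVirr n
  have hk₀ : k₀ ≤ 0 := exponent_nonpos_of_hasUnitContent g₀ _ k₀ hι₀ (hint W hW hirr f hf) hu₀
  have hk₁ : k₁ ≤ 0 :=
    exponent_nonpos_of_hasUnitContent g₁ _ k₁ hι₁ (hint W₁ hord₁ hirr₁ f₁ hf₁) hu₁
  have hk₂ : k₂ ≤ 0 :=
    exponent_nonpos_of_hasUnitContent g₂ _ k₂ hι₂ (hint W₂ hord₂ hirr₂ f₂ hf₂) hu₂
  have hk₃ : k₃ ≤ 0 :=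
    exponent_nonpos_of_hasUnitContent g₃ _ k₃ hι₃ (hint W₃ hord₃ hirr₃ f₃ hf₃) hu₃
  obtain ⟨m₀, hm₀⟩ := Int.exists_eq_neg_ofNat hk₀
  obtain ⟨m₁, hm₁⟩ := Int.exists_eq_neg_ofNat hk₁
  obtain ⟨m₂, hm₂⟩ := Int.exists_eq_neg_ofNat hk₂
  obtain ⟨m₃, hm₃⟩ := Int.exists_eq_neg_ofNat hk₃
  -- rewrite `ι gᵢ = p^{-mᵢ} Lᵢ` as `p^{mᵢ} ι gᵢ = Lᵢ`
  have hp0 : (p : ℚ_[p]) ≠ 0 := by exact_mod_cast hpP.ne_zero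
  have flip : ∀ (g : IwasawaAlgebra p) (L : PowerSeries ℚ_[p]) (m : ℕ),
      iwasawaToPowerSeries p g = PowerSeries.C ((p : ℚ_[p]) ^ (-(m : ℤ))) * L →
      PowerSeries.C ((p : ℚ_[p]) ^ m) * iwasawaToPowerSeries p g = L := by
    intro g L m h
    rw [h, ← mul_assoc, ← map_mul, zpow_neg, zpow_natCast, mul_inv_cancel₀ (pow_ne_zero _ hp0),
      map_one, one_mul]
  have e₀ := flip g₀ _ m₀ (hm₀ ▸ hι₀)
  have e₁ := flip g₁ _ m₁ (hm₁ ▸ hι₁)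
  have e₂ := flip g₂ _ m₂ (hm₂ ▸ hι₂)
  have e₃ := flip g₃ _ m₃ (hm₃ ▸ hι₃)
  -- the four `p`-adic `L`-functions are nonzero (`ch X ≠ 0`, `ι` injective)
  have hL0 : ∀ (V : WeierstrassCurve ℚ) [V.IsElliptic] (DV : V.SelmerDualData κ γ)
      (g : IwasawaAlgebra p) (L : PowerSeries ℚ_[p]) (m : ℕ),
      DV.charIdeal = Ideal.span {g} →
      PowerSeries.C ((p : ℚ_[p]) ^ m) * iwasawaToPowerSeries p g = L → L ≠ 0 := by
    intro V _ DV g L m hc e hL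
    have hg0 : g ≠ 0 := fun h0 =>
      Module.charIdeal_ne_bot (IwasawaAlgebra p) DV.X (by
        change DV.charIdeal = ⊥
        rw [hc, h0, Ideal.span_singleton_eq_bot])
    rw [hL, mul_eq_zero] at e
    rcases e with e | e
    · have h' := congrArg (PowerSeries.coeff 0) e
      rw [PowerSeries.coeff_zero_C, map_zero] at h'
      exact pow_ne_zero m hp0 h'
    · exact hg0 (iwasawaToPowerSeries_injective p (by rw [e, map_zero]))
  set L₀ := padicLFunction f (unitRoot W p : ℚ_[p]) with hL₀
  set L₁ := padicLFunction f₁ (unitRoot W₁ p : ℚ_[p]) with hL₁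
  set L₂ := padicLFunction f₂ (unitRoot W₂ p : ℚ_[p]) with hL₂
  set L₃ := padicLFunction f₃ (unitRoot W₃ p : ℚ_[p]) with hL₃
  have hne₀ : L₀ ≠ 0 := hL0 W D g₀ L₀ m₀ hc₀ e₀
  have hne₁ : L₁ ≠ 0 := hL0 W₁ D₁ g₁ L₁ m₁ hc₁ e₁
  have hne₂ : L₂ ≠ 0 := hL0 W₂ D₂ g₂ L₂ m₂ hc₂ e₂
  have hne₃ : L₃ ≠ 0 := hL0 W₃ D₃ g₃ L₃ m₃ hc₃ e₃
  have hLprod : L₀ * L₁ * L₂ * L₃ ≠ 0 :=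
    mul_ne_zero (mul_ne_zero (mul_ne_zero hne₀ hne₁) hne₂) hne₃
  -- (5.3) on the generators, unit-normalised
  set u : ℚ_[p] := (ϖ₀ : ℚ_[p]) * (ϖ₁ : ℚ_[p]) * (ϖ₂ : ℚ_[p]) * (ϖ₃ : ℚ_[p]) with hudef
  have hu : ‖u‖ ≤ 1 := by
    rw [hudef, norm_mul, norm_mul, norm_mul, hϖ₀n, hϖ₁n, hϖ₂n, hϖ₃n]; norm_num
  have hιG' : iwasawaToPowerSeries p G = PowerSeries.C u * (L₀ * L₁ * L₂ * L₃) := by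
    rw [hιG, hudef, map_mul, map_mul, map_mul]; ring
  have hGmem : g₀ * g₁ * g₂ * g₃ ∈ Ideal.span {G} := by
    refine hG (Ideal.mul_mem_mul (Ideal.mul_mem_mul (Ideal.mul_mem_mul ?_ ?_) ?_) ?_)
    · rw [hc₀]; exact Ideal.mem_span_singleton_self _
    · rw [hc₁]; exact Ideal.mem_span_singleton_self _
    · rw [hc₂]; exact Ideal.mem_span_singleton_self _
    · rw [hc₃]; exact Ideal.mem_span_singleton_self _
  obtain ⟨hm0, -, -, -⟩ := exponents_eq_zero_of_prod_mem_span e₀ e₁ e₂ e₃ hLprod hu hιG' hGmem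
  refine ⟨ht₀, g₀, hc₀, ?_⟩
  rw [← e₀, hm0, pow_zero, map_one, one_mul]

end Literature.NumberTheory.EllipticCurves

end
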